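import Summits.ResolutionOfSingularities.ResolutionOfSingularities.Theorems.EquisingularLiftEquisingularLiftNatTransversalStrictTransformTrace
import HarnessLib

/-!
# [OURS · L1 W4.5(b) · EL♮(3) · T23-A′ (A′-3)] SLIM INTERFACE TWIN of the trace theorem for the B-TRACE brick's `htrace`

Crux EL♮(3) = stmt-ResolutionOfSingularities-20148. res-L1-w45b-lead-2's INTERFACE FLAG (2026-08-28T06:48:22Z), repair (F2): stub-4's member-transport
brick `Tower.exc₃_transport_transversal` (…NatTowerBTransversalTransport) consumes `htrace : ∀ 𝓕, 𝓕.comap jG = 𝓘⟨F⟩ → HasSNCWith [𝓕] C →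
(St_C 𝓕).comap j₂ = 𝓘⟨closure υ₂⁻¹(F ∖ Z)⟩`, and the round core′ has neither `hF2` nor `hFflat` per member; the SIG-v2-verbatim theorem
`comap_strictTransformIdeal_eq_vanishingIdeal_of_transversal` (…NatTransversalStrictTransformTrace) carries them as (unused) positional binders.
This file re-assembles the SAME proof with ONLY the consumed hypotheses, per-member arguments LAST:
`comap_strictTransformIdeal_eq_vanishingIdeal_of_transversal' hsq hθ hτ hυ₂ hcomm hsq₂ hC hCflat hT1 hT2 hF1 hE`.
Written by res-L1-w45b-stub-2 g12. OURS; NOT a statement of H. Hironaka's 2017 manuscript; AI-written, weaker than expert review. No `sorry`;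
standard axioms; DEF-FREE. `--supports stmt-ResolutionOfSingularities-20148 --as helper`. [cite: Liu2002, Thm. 8.1.19] [cite: Matsumura1987, Thm. 14.2]
-/

set_option linter.dupNamespace false
set_option linter.overlappingInstances false -- the binders carry `[IsDomain O] [IsDiscreteValuationRing O]`

noncomputable section

open CategoryTheory CategoryTheory.Limits AlgebraicGeometry TopologicalSpace Topology IsLocalRing
open Literature.AlgebraicGeometry.Resolution
open AlgebraicGeometry.Scheme.IdealSheafData

namespace Summit.ResolutionOfSingularities.ResolutionOfSingularities.Cruxes.EquisingularLiftNat.Sections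

section Slim

variable {O : Type} [CommRing O] [IsDomain O] [IsDiscreteValuationRing O] {k : Type} [Field k] {θ : O →+* k}
  {P : Scheme.{0}} {q : P ⟶ Spec (.of O)}
  {G G' X X₂ : Scheme.{0}} {σ : X ⟶ P} {jG : G ⟶ X} {tG : G ⟶ Spec (.of k)}
  {C 𝓕 : X.IdealSheafData} {τ : X₂ ⟶ X} {υ₂ : G' ⟶ G} {j₂ : G' ⟶ X₂} {t₂ : G' ⟶ Spec (.of k)}
  {Z F : Set G} {hZ : IsClosed Z} {hF : IsClosed F}

/-- **T23-A′ (A′-3), SLIM INTERFACE TWIN** (res-L1-w45b-lead-2's INTERFACE FLAG 2026-08-28T06:48:22Z, repair (F2)): the same theorem as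
`comap_strictTransformIdeal_eq_vanishingIdeal_of_transversal` (SIG v2 767f3543c2b2e4ae) WITHOUT the binders its proof does not consume
(`hXreg`, `hCreg`, `hF2`, `hFflat`, `[IsIntegral X]`, `[IsProper (σ ≫ q)]`, `[IsLocallyNoetherian G]`), so that stub-4's B-TRACE brick
`Tower.exc₃_transport_transversal` can discharge its hypothesis `htrace 𝓕 hF1 hE` from the round core's ambient data
(`hsq hθ hτ hυ₂ hcomm hsq₂ hC hCflat hT1 hT2`). [cite: Liu2002, Thm. 8.1.19] [cite: Matsumura1987, Thm. 14.2] [OURS · L1 W4.5b · T23-A′ (A′-3)]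
toward the B′-residues of stmt-ResolutionOfSingularities-20148; NOT a statement of the manuscript. -/
theorem comap_strictTransformIdeal_eq_vanishingIdeal_of_transversal' [IsLocallyNoetherian X] [IsLocallyNoetherian X₂]
    (hsq : IsPullback jG tG (σ ≫ q) (Spec.map (CommRingCat.ofHom θ))) (hθ : Function.Surjective θ)
    (hτ : IsBlowup τ C) (hυ₂ : IsBlowup υ₂ (vanishingIdeal ⟨Z, hZ⟩)) (hcomm : j₂ ≫ τ = υ₂ ≫ jG)
    (hsq₂ : IsPullback j₂ t₂ ((τ ≫ σ) ≫ q) (Spec.map (CommRingCat.ofHom θ)))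
    (hC : C.comap jG = vanishingIdeal ⟨Z, hZ⟩) (hCflat : Flat (C.subschemeι ≫ σ ≫ q))
    (hT1 : ∀ g ∈ Z ∩ F, stalkIdeal (vanishingIdeal (⟨Z, hZ⟩ : Closeds G)) g ⊔ stalkIdeal (vanishingIdeal (⟨F, hF⟩ : Closeds G)) g =
      maximalIdeal (G.presheaf.stalk g))
    (hT2 : ∀ g ∈ Z ∩ F, stalkIdeal (vanishingIdeal (⟨Z, hZ⟩ : Closeds G)) g ≠ maximalIdeal (G.presheaf.stalk g))
    (hF1 : 𝓕.comap jG = vanishingIdeal ⟨F, hF⟩) (hE : HasSNCWith [𝓕] C) :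
    (strictTransformIdeal τ C 𝓕).comap j₂ = vanishingIdeal (⟨closure (υ₂ ⁻¹' (F \ Z)), isClosed_closure⟩ : Closeds G') := by
  classical
  haveI : IsClosedImmersion (Spec.map (CommRingCat.ofHom θ)) := IsClosedImmersion.spec_of_surjective _ hθ
  haveI : IsClosedImmersion jG := MorphismProperty.IsStableUnderBaseChange.of_isPullback hsq.flip inferInstance
  haveI : IsClosedImmersion j₂ := MorphismProperty.IsStableUnderBaseChange.of_isPullback hsq₂.flip inferInstance
  set L := (strictTransformIdeal τ C 𝓕).comap j₂ with hL
  have hpt : ∀ y : G', τ (j₂ y) = jG (υ₂ y) := fun y => by rw [← Scheme.Hom.comp_apply, hcomm, Scheme.Hom.comp_apply]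
  have hZsupp : ∀ g : G, g ∈ Z ↔ jG g ∈ C.support := fun g => by
    have h : g ∈ ((C.comap jG).support : Set G) ↔ jG g ∈ C.support := by
      rw [Scheme.IdealSheafData.support_comap]; rfl
    rw [← h, hC, Scheme.IdealSheafData.coe_support_vanishingIdeal]; rfl
  have hFsupp : ∀ g : G, g ∈ F ↔ jG g ∈ 𝓕.support := fun g => by
    have h : g ∈ ((𝓕.comap jG).support : Set G) ↔ jG g ∈ 𝓕.support := by
      rw [Scheme.IdealSheafData.support_comap]; rfl
    rw [← h, hF1, Scheme.IdealSheafData.coe_support_vanishingIdeal]; rfl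
  have hLoff : ∀ y : G', υ₂ y ∉ Z → stalkIdeal L y = stalkIdeal ((vanishingIdeal (⟨F, hF⟩ : Closeds G)).comap υ₂) y := by
    intro y hy
    have hx : τ (j₂ y) ∉ C.support := by rw [hpt]; exact fun h => hy ((hZsupp _).mpr h)
    rw [hL, stalkIdeal_comap_eq_map_stalkMap, stalkIdeal_strictTransformIdeal_of_not_mem_support (π := τ) C 𝓕 hx,
      ← stalkIdeal_comap_eq_map_stalkMap τ 𝓕, ← stalkIdeal_comap_eq_map_stalkMap j₂ (𝓕.comap τ),
      ← Scheme.IdealSheafData.comap_comp, hcomm, Scheme.IdealSheafData.comap_comp, hF1]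
  have hmem_off : ∀ y : G', υ₂ y ∉ Z → (y ∈ L.support ↔ υ₂ y ∈ F) := by
    intro y hy
    rw [mem_support_iff_stalkIdeal_le, hLoff y hy, ← mem_support_iff_stalkIdeal_le, Scheme.IdealSheafData.support_comap]
    change υ₂ y ∈ ((vanishingIdeal (⟨F, hF⟩ : Closeds G)).support : Set G) ↔ _
    rw [Scheme.IdealSheafData.coe_support_vanishingIdeal]; rfl
  have hrad_off : ∀ y : G', υ₂ y ∉ Z → (stalkIdeal L y).IsRadical := by
    intro y hy
    rw [hLoff y hy, stalkIdeal_comap_eq_map_stalkMap]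
    have hyZ : υ₂ y ∉ (vanishingIdeal (⟨Z, hZ⟩ : Closeds G)).support := by
      change υ₂ y ∉ ((vanishingIdeal (⟨Z, hZ⟩ : Closeds G)).support : Set G)
      rw [Scheme.IdealSheafData.coe_support_vanishingIdeal]; exact hy
    haveI := hυ₂.isIso_stalkMap_of_not_mem_support hyZ
    haveI := ComponentGluing.isReduced_subscheme_vanishingIdeal (⟨F, hF⟩ : Closeds G)
    exact isRadical_map_of_bijective _ (ConcreteCategory.bijective_of_isIso (υ₂.stalkMap y))
      (isRadical_stalkIdeal_of_isReduced_subscheme (vanishingIdeal (⟨F, hF⟩ : Closeds G)) (υ₂ y))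
  have hnot : ∀ y : G', υ₂ y ∈ Z → υ₂ y ∉ F → y ∉ L.support := by
    intro y _ hyF hyL
    apply hyF
    rw [hFsupp, ← hpt]
    have h1 : j₂ y ∈ (strictTransformIdeal τ C 𝓕).support := by
      rw [hL, Scheme.IdealSheafData.support_comap] at hyL; exact hyL
    have h2 : j₂ y ∈ (𝓕.comap τ).support :=
      Scheme.IdealSheafData.support_antitone
        ((comap_le_controlledTransform τ C 𝓕 0).trans (controlledTransform_le_strictTransformIdeal τ C 𝓕 0)) h1
    rw [Scheme.IdealSheafData.support_comap] at h2; exact h2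
  have hrad : L.radical = L := by
    rw [radical_eq_iff_forall_stalkIdeal]
    intro y
    by_cases hyZ : υ₂ y ∈ Z
    · by_cases hyF : υ₂ y ∈ F
      · exact (transversal_crossing_package hsq hθ hτ hcomm hsq₂ hC hCflat hE hF1 hT1 hT2 hmem_off y ⟨hyZ, hyF⟩).1.isRadical
      · rw [stalkIdeal_eq_top_of_not_mem_support (hnot y hyZ hyF)]
        exact fun _ _ => Submodule.mem_top
    · exact hrad_off y hyZ
  have hsupp : (L.support : Set G') = closure (υ₂ ⁻¹' (F \ Z)) := by
    apply le_antisymm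
    · intro y hyL
      by_cases hyZ : υ₂ y ∈ Z
      · by_cases hyF : υ₂ y ∈ F
        · exact (transversal_crossing_package hsq hθ hτ hcomm hsq₂ hC hCflat hE hF1 hT1 hT2 hmem_off y ⟨hyZ, hyF⟩).2.2
        · exact absurd hyL (hnot y hyZ hyF)
      · exact subset_closure ⟨(hmem_off y hyZ).mp hyL, hyZ⟩
    · exact closure_minimal (fun y hy => (hmem_off y hy.2).mpr hy.1) L.support.isClosed
  rw [← hrad, ← vanishingIdeal_support]
  congr 1
  exact TopologicalSpace.Closeds.ext hsupp

end Slim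

end Summit.ResolutionOfSingularities.ResolutionOfSingularities.Cruxes.EquisingularLiftNat.Sections

end
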